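import Literature.Computability.AlgebraicComplexity.LRTorusWeights
import HarnessLib

/-!
# Landsberg–Ressayre, Thm. 2.8 — the weights of the canonical subspaces (LR17 §6)

Topic `Literature/Computability/AlgebraicComplexity`.  Continues `LRTorusWeights.lean` (torus datum
`D`, weights `wt u`, comparison spaces `Z S' u`) in the bottom-up proof of
`lr_left_equivariant_lower` (LR17 Thm. 2.8):

* `comap_le_iSup`, `comap_le_iSup_sup_ker`: the weights of `Λ⁻¹ P` for a `B`-stable `P`
  (LR17 §6: `Λ` identifies `ℂⁿ/ℓ_1` with `ℍ` equivariantly);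
* **weights of `𝒫_S`** (LR17 §6: "`k₀ Wt(T̃, ℍ_i^* ⊗ ℍ_{i+1})` has to contain `k₀ Wt(T̃, E)`",
  i.e. weights grow by one `ε_u` per step of the chain): `canon_le_grid` —
  `𝒫_S ⊆ ⨁_{0 ≠ u, supp u ⊆ S} E (wt u)`; `canon_inf_wt_le_canon_supp` — the weight-`wt u` part
  of `𝒫_S` already lies in `𝒫_{supp u}`; `canon_le_iSup_inf` — `𝒫_S` is the sum of these parts;
* **descent** (`exists_pred_of_canon_inf_wt_ne_bot`): a weight `wt u` of `𝒫_S` with `u` not a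
  unit vector comes from a weight `wt (u - e_k)` of `𝒫_S ∩ range Λ` with `k ∈ S` (LR's inequality
  `ℓ(χ_{ℍ_{i+1}}) ≤ ℓ(χ_{ℍ_i}) + 1`, read downwards).

## References

* J. M. Landsberg, N. Ressayre, *Permanent v. determinant: an exponential lower bound assuming
  symmetry and a potential path towards Valiant's conjecture*, Differential Geom. Appl. 55 (2017)
  146–166, arXiv:1508.05788, §6 (proof of Thm. 2.8).
-/

noncomputable section

namespace Literature.Computability.AlgebraicComplexity

namespace LRPencil

namespace TorusData

open Submodule Module.End Finset

variable {V : Type*} [AddCommGroup V] [Module ℂ V] [FiniteDimensional ℂ V] {m : ℕ}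
  (D : TorusData m V)

/-! ### Weights of `Λ⁻¹ P` -/

/-- For a `B`-stable `P`: `Λ⁻¹ P ⊆ Σ_γ (Λ⁻¹ (P ∩ E γ) ∩ F γ)` (apply the weight decomposition to
the `C`-stable `Λ⁻¹ P`). [cite: LandsbergRessayre2017, §6] -/
theorem comap_le_iSup {P : Submodule ℂ V} (hP : P.map D.B ≤ P) :
    P.comap D.Λ ≤ ⨆ γ, (P ⊓ D.E γ).comap D.Λ ⊓ D.F γ := by
  have hW : (P.comap D.Λ).map D.C ≤ P.comap D.Λ := by
    rw [← D.L.comap_map_eq]; exact Submodule.comap_mono hP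
  calc P.comap D.Λ = ⨆ γ, P.comap D.Λ ⊓ D.F γ := eq_iSup_inf_maxGen _ hW
    _ ≤ ⨆ γ, (P ⊓ D.E γ).comap D.Λ ⊓ D.F γ := iSup_mono fun γ => ?_
  rintro w ⟨hw, hwγ⟩
  refine ⟨?_, hwγ⟩
  simp only [SetLike.mem_coe, Submodule.mem_comap, Submodule.mem_inf] at hw ⊢
  exact ⟨hw, D.map_Λ_F_le γ (Submodule.mem_map_of_mem hwγ)⟩

/-- The same when the weights of `P` lie in a given family `w`: `Λ⁻¹ P` is contained in
`Σ_i (Λ⁻¹ (P ∩ E (w i)) ∩ F (w i)) + ker Λ`. [cite: LandsbergRessayre2017, §6] -/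
theorem comap_le_iSup_sup_ker {ι : Type*} (w : ι → ℂ) {P : Submodule ℂ V}
    (hP : P.map D.B ≤ P) (hPw : P ≤ ⨆ i, D.E (w i)) :
    P.comap D.Λ ≤ (⨆ i, (P ⊓ D.E (w i)).comap D.Λ ⊓ D.F (w i)) ⊔ LinearMap.ker D.Λ := by
  refine (D.comap_le_iSup hP).trans (iSup_le fun γ => ?_)
  by_cases h : ∃ i, w i = γ
  · obtain ⟨i, rfl⟩ := h
    exact (le_iSup (fun i => (P ⊓ D.E (w i)).comap D.Λ ⊓ D.F (w i)) i).trans le_sup_left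
  · push Not at h
    have h0 : P ⊓ D.E γ = ⊥ := by
      rw [eq_bot_iff]
      calc P ⊓ D.E γ ≤ (⨆ i, D.E (w i)) ⊓ D.E γ := inf_le_inf_right _ hPw
        _ = ⊥ := iSup_maxGen_inf_eq_bot _ w h
    rw [h0, Submodule.comap_bot]
    exact inf_le_left.trans le_sup_right

/-! ### Weights of the canonical subspaces -/

/-- The comparison space `Σ_{u ∈ U S} Z S' u` is closed under the rows in `S`, hence contains
`𝒫_S`. [folklore] -/
theorem canon_le_iSup_Z (S S' : Finset (Fin m)) : canon D.Λ D.A S ≤ ⨆ u : U S, D.Z S' u := by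
  set G : Submodule ℂ V := ⨆ u : U S, D.Z S' u with hG
  have hGst : G.map D.B ≤ G := by
    rw [hG, Submodule.map_iSup]
    exact iSup_mono fun u => D.map_Z_le S' u
  have hGw : G ≤ ⨆ u : U S, D.E (D.wt u) := iSup_mono fun u => D.Z_le_E S' u
  have hpiece : ∀ u : U S, G ⊓ D.E (D.wt u) ≤ D.Z S' u := fun u => by
    refine (iSup_inf_maxGen_le _ (fun u : U S => D.Z S' u) (fun u => D.wt u)
      (fun u => D.Z_le_E S' u) (D.wt u)).trans (iSup₂_le fun u' hu' => ?_)
    rw [Subtype.ext (D.wt_injective hu')]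
  apply canon_le
  intro k hk j
  refine (Submodule.map_mono (D.comap_le_iSup_sup_ker (fun u : U S => D.wt u) hGst hGw)).trans ?_
  rw [Submodule.map_sup, Submodule.map_iSup]
  refine sup_le (iSup_le fun u => ?_) ?_
  · calc (((G ⊓ D.E (D.wt u)).comap D.Λ ⊓ D.F (D.wt u)).map (D.A k j))
        ≤ (((D.Z S' u).comap D.Λ ⊓ D.F (D.wt u)).map (D.A k j)) :=
          Submodule.map_mono (inf_le_inf_right _ (Submodule.comap_mono (hpiece u)))
      _ ≤ D.Z S' ((u : Fin m → ℕ) + Pi.single k 1) := D.map_comap_Z_le S' k j u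
      _ ≤ G := le_iSup (fun u : U S => D.Z S' u) ⟨(u : Fin m → ℕ) + Pi.single k 1,
          add_single_mem_U u.2.2 hk⟩
  · calc (LinearMap.ker D.Λ).map (D.A k j) ≤ D.Z S' (0 + Pi.single k 1) := D.map_ker_le_Z S' k j
      _ ≤ G := le_iSup (fun u : U S => D.Z S' u) ⟨_, single_mem_U hk⟩

/-- **Weights of `𝒫_S` refine along supports** (LR17 §6, "`χ_{ℍ_{i+1}} = σ χ_{ℍ_i} + k₀ ε_u`":
a weight vector is reached only through the rows in its support): for `u ≠ 0` with
`supp u ⊆ S'`, the weight-`wt u` part of `𝒫_S` lies in `𝒫_{S'}`. [cite: LandsbergRessayre2017, §6] -/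
theorem canon_inf_wt_le {S S' : Finset (Fin m)} {u : Fin m → ℕ} (hU : u ∈ U S)
    (hu : supp u ⊆ S') : canon D.Λ D.A S ⊓ D.E (D.wt u) ≤ canon D.Λ D.A S' ⊓ D.E (D.wt u) :=
  calc canon D.Λ D.A S ⊓ D.E (D.wt u) ≤ (⨆ u : U S, D.Z S' u) ⊓ D.E (D.wt u) :=
        inf_le_inf_right _ (D.canon_le_iSup_Z S S')
    _ ≤ ⨆ (u' : U S) (_ : D.wt u' = D.wt u), D.Z S' u' :=
        iSup_inf_maxGen_le _ _ (fun u' : U S => D.wt u') (fun u' => D.Z_le_E S' u') _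
    _ ≤ D.Z S' u := iSup₂_le fun u' hu' => by
        rw [show u' = ⟨u, hU⟩ from Subtype.ext (D.wt_injective hu')]
    _ = canon D.Λ D.A S' ⊓ D.E (D.wt u) := if_pos hu

/-- In particular the weight-`wt u` part of `𝒫_S` lies in `𝒫_{supp u}`. [cite: LandsbergRessayre2017, §6] -/
theorem canon_inf_wt_le_canon_supp {S : Finset (Fin m)} {u : Fin m → ℕ} (hu : u ∈ U S) :
    canon D.Λ D.A S ⊓ D.E (D.wt u) ≤ canon D.Λ D.A (supp u) :=
  (D.canon_inf_wt_le hu subset_rfl).trans inf_le_left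

/-- **The weights of `𝒫_S`** are among the `wt u`, `0 ≠ u`, `supp u ⊆ S`:
`𝒫_S ⊆ ⨁_{u ∈ U S} E (wt u)` (LR17 §6: the weights of the chain are sums of `ε_u`'s).
[cite: LandsbergRessayre2017, §6] -/
theorem canon_le_grid (S : Finset (Fin m)) : canon D.Λ D.A S ≤ ⨆ u : U S, D.E (D.wt u) :=
  (D.canon_le_iSup_Z S ∅).trans (iSup_mono fun u => D.Z_le_E ∅ u)

/-- Hence `𝒫_S` is the sum of its pieces of weight `wt u`, `u ∈ U S`. [cite: LandsbergRessayre2017, §6] -/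
theorem canon_le_iSup_inf (S : Finset (Fin m)) :
    canon D.Λ D.A S ≤ ⨆ u : U S, canon D.Λ D.A S ⊓ D.E (D.wt u) := by
  have hst : (canon D.Λ D.A S).map D.B ≤ canon D.Λ D.A S := (D.L.map_canon_eq_self S).le
  conv_lhs => rw [eq_iSup_inf_maxGen _ hst]
  refine iSup_le fun β => ?_
  by_cases h : ∃ u : U S, D.wt u = β
  · obtain ⟨u, rfl⟩ := h
    exact le_iSup (fun u : U S => canon D.Λ D.A S ⊓ D.E (D.wt u)) u
  · push Not at h
    have : canon D.Λ D.A S ⊓ D.E β = ⊥ := by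
      rw [eq_bot_iff]
      calc canon D.Λ D.A S ⊓ D.E β ≤ (⨆ u : U S, D.E (D.wt u)) ⊓ D.E β :=
            inf_le_inf_right _ (D.canon_le_grid S)
        _ = ⊥ := iSup_maxGen_inf_eq_bot _ _ h
    rw [this]; exact bot_le

/-! ### Descent -/

/-- **Descent** (LR17 §6, `ℓ(χ_{ℍ_{i+1}}) ≤ ℓ(χ_{ℍ_i}) + 1`, read downwards): if `𝒫_S` has weight
`wt u` with `u ≠ e_k` for all `k` (e.g. `|u| ≥ 2`), then `u = u' + e_k` with `k ∈ S`, `u' ∈ U S`,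
and `wt u'` is a weight of `𝒫_S ∩ range Λ`. [cite: LandsbergRessayre2017, §6] -/
theorem exists_pred_of_canon_inf_wt_ne_bot {S : Finset (Fin m)} {u : Fin m → ℕ}
    (hu1 : ∀ k, u ≠ 0 + Pi.single k 1) (hne : canon D.Λ D.A S ⊓ D.E (D.wt u) ≠ ⊥) :
    ∃ k ∈ S, ∃ u' ∈ U S, u = u' + Pi.single k 1 ∧
      canon D.Λ D.A S ⊓ D.E (D.wt u') ⊓ LinearMap.range D.Λ ≠ ⊥ := by
  classical
  set P := canon D.Λ D.A S with hP
  have hst : P.map D.B ≤ P := (D.L.map_canon_eq_self S).le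
  -- the candidate pieces, indexed by `(k, j, u')` (`u' = none` encodes `ker Λ`)
  let Y : Fin m × Fin m × Option (U S) → Submodule ℂ V := fun i =>
    if i.1 ∈ S then
      (match i.2.2 with
        | some u' => ((P ⊓ D.E (D.wt u')).comap D.Λ ⊓ D.F (D.wt u')).map (D.A i.1 i.2.1)
        | none => (LinearMap.ker D.Λ).map (D.A i.1 i.2.1))
    else ⊥
  let w : Fin m × Fin m × Option (U S) → ℂ := fun i =>
    match i.2.2 with
    | some u' => D.wt (u'.1 + Pi.single i.1 1)
    | none => D.wt (0 + Pi.single i.1 1)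
  have hY : ∀ i, Y i ≤ D.E (w i) := by
    rintro ⟨k, j, _ | u'⟩
    · by_cases hk : k ∈ S
      · simp only [Y, w, if_pos hk]; exact D.map_A_ker_le k j
      · simp only [Y, if_neg hk]; exact bot_le
    · by_cases hk : k ∈ S
      · simp only [Y, w, if_pos hk]
        exact (Submodule.map_mono inf_le_right).trans (D.map_A_F_wt_le k j u')
      · simp only [Y, if_neg hk]; exact bot_le
  have hPY : P ≤ ⨆ i, Y i := by
    refine (canon_le_step S).trans (iSup₂_le fun k hk => iSup_le fun j => ?_)
    refine (Submodule.map_mono (D.comap_le_iSup_sup_ker (fun u : U S => D.wt u) hst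
      (D.canon_le_grid S))).trans ?_
    rw [Submodule.map_sup, Submodule.map_iSup]
    refine sup_le (iSup_le fun u' => ?_) ?_
    · refine le_trans (le_of_eq ?_) (le_iSup Y (k, j, some u'))
      simp only [Y, if_pos hk]
    · refine le_trans (le_of_eq ?_) (le_iSup Y (k, j, none))
      simp only [Y, if_pos hk]
  have hex : P ⊓ D.E (D.wt u) ≤ ⨆ (i) (_ : w i = D.wt u), Y i :=
    (inf_le_inf_right _ hPY).trans (iSup_inf_maxGen_le _ Y w hY _)
  -- some candidate piece of weight `wt u` is non-zero
  obtain ⟨i, hwi, hYi⟩ : ∃ i, w i = D.wt u ∧ Y i ≠ ⊥ := by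
    by_contra hall
    push Not at hall
    apply hne
    rw [eq_bot_iff]
    exact hex.trans (iSup₂_le fun i hi => (hall i hi).le)
  rcases i with ⟨k, j, _ | u'⟩
  · exact (hu1 k (D.wt_injective hwi).symm).elim
  · have hk : k ∈ S := by
      by_contra hk
      exact hYi (by simp only [Y, if_neg hk])
    have hYi' : ((P ⊓ D.E (D.wt u')).comap D.Λ ⊓ D.F (D.wt u')).map (D.A k j) ≠ ⊥ := by
      intro h; apply hYi; simp only [Y, if_pos hk]; exact h
    refine ⟨k, hk, u', u'.2, (D.wt_injective hwi).symm, ?_⟩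
    -- a non-zero vector of `Λ⁻¹(P ∩ E (wt u')) ∩ F (wt u')` is not in `ker Λ`
    intro hbot
    apply hYi'
    rw [eq_bot_iff]
    rintro _ ⟨x, ⟨hx1, hx2⟩, rfl⟩
    rw [Submodule.mem_bot]
    have hΛx : D.Λ x ∈ P ⊓ D.E (D.wt u') ⊓ LinearMap.range D.Λ :=
      ⟨hx1, LinearMap.mem_range_self _ _⟩
    rw [hbot, Submodule.mem_bot] at hΛx
    have hxK : x ∈ LinearMap.ker D.Λ ⊓ D.F (D.wt u') := ⟨hΛx, hx2⟩
    rw [D.ker_inf_F_wt_eq_bot u'.2.1, Submodule.mem_bot] at hxK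
    rw [hxK, map_zero]

end TorusData

end LRPencil

end Literature.Computability.AlgebraicComplexity
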